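import Mathlib
import Summits.Ventures.PercRepro2.ZMeanProof
import Summits.Ventures.PercRepro2.PendantRoot
import Summits.Ventures.PercRepro2.PocketTransport
import Summits.Ventures.PercRepro2.StarGlue
import Summits.Ventures.PercRepro2.StarOEvents
import Summits.Ventures.PercRepro2.StarOProb

/-!
# The three-coin star at `a₃` (class O): the T-masses and the Q-masses with a connection
(blind cell PercRepro2, night-1 g8; NIGHT1-G8.md §4)

`T = Q ∩ {a₃ ∈ C₂}` lives on three outcomes: only `f₂` open (`T = Q₁`), only `f₃` open
(`a₃ ∈ C₂` iff `o ∈ C₂`), and `f₂, f₃` open (`a₂` and `o` glued to `a₃`: `Q` iff `Q₁` and `o ↮ a₁`;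
connections among the other vertices are the `glue23` connections): `prob_T_inter_conn_star` gives
`P(T, x ↔ y)` for `x, y ≠ a₃` (the mirror `T′` is the same statement with the roots swapped).
`P(Q, x ↔ y)` (`prob_Q_inter_conn_star`): on the single-glue outcomes `P₀(Q, x ↔ y)`; with `f₁, f₃`
open `Q` is `Q₁ ∩ {o ↮ a₂}` and `x ↔ y` is the `glue13` connection; with `f₂, f₃` open the mirror.
These give `E_Q[σ₃]`, `E_Q[σ₃ 1_{o ∈ U}]`, `Δ_T`, `E_Q[σ_o]` and the gap (`gap_eq_on_Q`).
-/

namespace Summit.Ventures.PercRepro2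

open StarGlue PendantRoot UnionCluster



namespace StarO

section MassT

variable {V : Type*} {E : Type*} [Fintype E] [DecidableEq E] [Fintype V] [DecidableEq V]
  {R : Type*} [Field R] [LinearOrder R] [IsStrictOrderedRing R]

variable (p : E → R) (ends : E → Sym2 V) {f₁ f₂ f₃ : E} {a₃ a₁ a₂ o : V}

omit [Fintype E] [DecidableEq E] [Fintype V] [DecidableEq V] in
/-- Membership in `T`. -/
lemma mem_T {ω : Config E} :
    ω ∈ TEvent ends a₁ a₂ a₃ ↔ ¬ Conn ends ω a₂ a₁ ∧ Conn ends ω a₂ a₃ := by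
  simp only [TEvent, Set.mem_inter_iff, Set.mem_compl_iff, mem_connEvent]

/-- The connections of the star-closed configuration with `a₂` and `o` glued. -/
def glue23 (a₂ o x y : V) : Set (Config E) :=
  connEvent ends x y ∪ ((connEvent ends x a₂ ∩ connEvent ends o y) ∪
    (connEvent ends x o ∩ connEvent ends a₂ y))

omit [Fintype E] [DecidableEq E] [Fintype V] [DecidableEq V] in
/-- `T ∩ outc` is empty when `f₁` is open (then `a₃ ∈ C₁`, so `a₃ ∈ C₂` contradicts `Q`). -/
lemma T_inter_outc_f1 (hf₁ : ends f₁ = s(a₃, a₁)) (X : Set (Config E)) {b₂ b₃ : Bool} :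
    TEvent ends a₁ a₂ a₃ ∩ X ∩ outc f₁ f₂ f₃ true b₂ b₃ = ∅ := by
  ext ω
  simp only [Set.mem_inter_iff, mem_T, mem_outc, Set.mem_empty_iff_false, iff_false, not_and]
  rintro ⟨⟨hQ, h23⟩, _⟩ h1 _ _
  exact hQ (conn_trans h23 (conn_of_openAdj ⟨f₁, h1, hf₁⟩))

omit [Fintype E] [DecidableEq E] in
/-- `T ∩ outc` is empty when every coin is closed (`a₃` isolated). -/
lemma T_inter_outc_ccc (hf₁ : ends f₁ = s(a₃, a₁)) (hf₂ : ends f₂ = s(a₃, a₂))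
    (hf₃ : ends f₃ = s(a₃, o)) (hstar : ∀ e, a₃ ∈ ends e → e = f₁ ∨ e = f₂ ∨ e = f₃)
    (h31 : a₃ ≠ a₁) (h32 : a₃ ≠ a₂) (h3o : a₃ ≠ o) (X : Set (Config E)) :
    TEvent ends a₁ a₂ a₃ ∩ X ∩ outc f₁ f₂ f₃ false false false = ∅ := by
  ext ω
  simp only [Set.mem_inter_iff, mem_T, mem_outc, Set.mem_empty_iff_false, iff_false, not_and]
  rintro ⟨⟨_, h23⟩, _⟩ h1 h2 h3
  exact not_conn_a3_ccc hf₁ hf₂ hf₃ hstar h31 h32 h3o h1 h2 h3 h32.symm (conn_symm h23)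

omit [Fintype E] [DecidableEq E] in
/-- `T ∩ (x ↔ y) ∩ outc` with only `f₂` open: `Q₁ ∩ (x ↔ y)₁`. -/
lemma T_inter_outc_f2 (hf₁ : ends f₁ = s(a₃, a₁)) (hf₂ : ends f₂ = s(a₃, a₂))
    (hf₃ : ends f₃ = s(a₃, o)) (hstar : ∀ e, a₃ ∈ ends e → e = f₁ ∨ e = f₂ ∨ e = f₃)
    (h31 : a₃ ≠ a₁) (h32 : a₃ ≠ a₂) (h3o : a₃ ≠ o) {x y : V} (hx : x ≠ a₃) (hy : y ≠ a₃) :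
    TEvent ends a₁ a₂ a₃ ∩ connEvent ends x y ∩ outc f₁ f₂ f₃ false true false =
      viaStar ends a₃ (avoidAll ends a₂ {a₁} ∩ connEvent ends x y) ∩
        outc f₁ f₂ f₃ false true false := by
  ext ω
  simp only [Set.mem_inter_iff, mem_T, mem_outc, viaStar, Set.mem_setOf_eq, avoidAll_eq_compl,
    Set.mem_compl_iff, mem_connEvent]
  have hs : ∀ {u v : V}, u ≠ a₃ → v ≠ a₃ → ω f₁ = false → ω f₂ = true → ω f₃ = false →
      (Conn ends ω u v ↔ Conn ends (closeStar ends a₃ ω) u v) := fun hu hv h1 h2 h3 =>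
    conn_iff_single hf₁ hf₂ hf₃ hstar h31 h32 h3o (by simp [h1]) (by simp [h1]) (by simp [h3]) hu hv
  constructor
  · rintro ⟨⟨⟨hQ, _⟩, hxy⟩, h1, h2, h3⟩
    rw [hs h32.symm h31.symm h1 h2 h3] at hQ
    rw [hs hx hy h1 h2 h3] at hxy
    exact ⟨⟨fun h => hQ (conn_symm h), hxy⟩, h1, h2, h3⟩
  · rintro ⟨⟨hQ, hxy⟩, h1, h2, h3⟩
    refine ⟨⟨⟨?_, conn_symm (conn_of_openAdj ⟨f₂, h2, hf₂⟩)⟩, ?_⟩, h1, h2, h3⟩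
    · rw [hs h32.symm h31.symm h1 h2 h3]; exact fun h => hQ (conn_symm h)
    · rw [hs hx hy h1 h2 h3]; exact hxy

omit [Fintype E] [DecidableEq E] in
/-- `T ∩ (x ↔ y) ∩ outc` with only `f₃` open: `Q₁ ∩ (o ∈ C₂)₁ ∩ (x ↔ y)₁`. -/
lemma T_inter_outc_f3 (hf₁ : ends f₁ = s(a₃, a₁)) (hf₂ : ends f₂ = s(a₃, a₂))
    (hf₃ : ends f₃ = s(a₃, o)) (hstar : ∀ e, a₃ ∈ ends e → e = f₁ ∨ e = f₂ ∨ e = f₃)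
    (h31 : a₃ ≠ a₁) (h32 : a₃ ≠ a₂) (h3o : a₃ ≠ o) {x y : V} (hx : x ≠ a₃) (hy : y ≠ a₃) :
    TEvent ends a₁ a₂ a₃ ∩ connEvent ends x y ∩ outc f₁ f₂ f₃ false false true =
      viaStar ends a₃ (avoidAll ends a₂ {a₁} ∩ connEvent ends a₂ o ∩ connEvent ends x y) ∩
        outc f₁ f₂ f₃ false false true := by
  ext ω
  simp only [Set.mem_inter_iff, mem_T, mem_outc, viaStar, Set.mem_setOf_eq, avoidAll_eq_compl,
    Set.mem_compl_iff, mem_connEvent]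
  have hs : ∀ {u v : V}, u ≠ a₃ → v ≠ a₃ → ω f₁ = false → ω f₂ = false → ω f₃ = true →
      (Conn ends ω u v ↔ Conn ends (closeStar ends a₃ ω) u v) := fun hu hv h1 h2 h3 =>
    conn_iff_single hf₁ hf₂ hf₃ hstar h31 h32 h3o (by simp [h1]) (by simp [h1]) (by simp [h2]) hu hv
  constructor
  · rintro ⟨⟨⟨hQ, h23⟩, hxy⟩, h1, h2, h3⟩
    rw [hs h32.symm h31.symm h1 h2 h3] at hQ
    rw [hs hx hy h1 h2 h3] at hxy
    have h23' := conn_symm h23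
    rw [conn_a3_iff_o_of_f3 hf₃ h3, hs h3o.symm h32.symm h1 h2 h3] at h23'
    exact ⟨⟨⟨fun h => hQ (conn_symm h), conn_symm h23'⟩, hxy⟩, h1, h2, h3⟩
  · rintro ⟨⟨⟨hQ, h2o⟩, hxy⟩, h1, h2, h3⟩
    refine ⟨⟨⟨?_, ?_⟩, ?_⟩, h1, h2, h3⟩
    · rw [hs h32.symm h31.symm h1 h2 h3]; exact fun h => hQ (conn_symm h)
    · apply conn_symm
      rw [conn_a3_iff_o_of_f3 hf₃ h3, hs h3o.symm h32.symm h1 h2 h3]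
      exact conn_symm h2o
    · rw [hs hx hy h1 h2 h3]; exact hxy

omit [Fintype E] [DecidableEq E] in
/-- `T ∩ (x ↔ y) ∩ outc` with `f₂, f₃` open: `Q₁ ∩ (o ↮ a₁)₁ ∩ glue23(x, y)`. -/
lemma T_inter_outc_f23 (hf₁ : ends f₁ = s(a₃, a₁)) (hf₂ : ends f₂ = s(a₃, a₂))
    (hf₃ : ends f₃ = s(a₃, o)) (hstar : ∀ e, a₃ ∈ ends e → e = f₁ ∨ e = f₂ ∨ e = f₃)
    (h31 : a₃ ≠ a₁) (h32 : a₃ ≠ a₂) (h3o : a₃ ≠ o) {x y : V} (hx : x ≠ a₃) (hy : y ≠ a₃) :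
    TEvent ends a₁ a₂ a₃ ∩ connEvent ends x y ∩ outc f₁ f₂ f₃ false true true =
      viaStar ends a₃ (avoidAll ends a₂ {a₁} ∩ (connEvent ends o a₁)ᶜ ∩ glue23 ends a₂ o x y) ∩
        outc f₁ f₂ f₃ false true true := by
  ext ω
  simp only [Set.mem_inter_iff, mem_T, mem_outc, viaStar, Set.mem_setOf_eq, avoidAll_eq_compl,
    Set.mem_compl_iff, mem_connEvent, glue23, Set.mem_union]
  constructor
  · rintro ⟨⟨⟨hQ, _⟩, hxy⟩, h1, h2, h3⟩
    rw [conn_iff_glue23 hf₁ hf₂ hf₃ hstar h31 h32 h3o h1 h2 h3 h32.symm h31.symm] at hQ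
    rw [conn_iff_glue23 hf₁ hf₂ hf₃ hstar h31 h32 h3o h1 h2 h3 hx hy] at hxy
    push Not at hQ
    exact ⟨⟨⟨fun h => hQ.1 (conn_symm h), fun h => hQ.2.1 (conn_refl _ _ _) h⟩, hxy⟩, h1, h2, h3⟩
  · rintro ⟨⟨⟨hQ, ho⟩, hxy⟩, h1, h2, h3⟩
    refine ⟨⟨⟨?_, conn_symm (conn_of_openAdj ⟨f₂, h2, hf₂⟩)⟩, ?_⟩, h1, h2, h3⟩
    · rw [conn_iff_glue23 hf₁ hf₂ hf₃ hstar h31 h32 h3o h1 h2 h3 h32.symm h31.symm]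
      rintro (h | ⟨_, h⟩ | ⟨_, h⟩)
      · exact hQ (conn_symm h)
      · exact ho h
      · exact hQ (conn_symm h)
    · rw [conn_iff_glue23 hf₁ hf₂ hf₃ hstar h31 h32 h3o h1 h2 h3 hx hy]
      exact hxy

omit [LinearOrder R] [IsStrictOrderedRing R] in
/-- **`P(T, x ↔ y)`** for `x, y ≠ a₃`:
`βᾱr̄ P₀(Q, x↔y) + ᾱβ̄r P₀(Q, o ∈ C₂, x↔y) + βᾱr P₀(Q, o ↮ a₁, glue23(x,y))`. -/
theorem prob_T_inter_conn_star (hf₁ : ends f₁ = s(a₃, a₁)) (hf₂ : ends f₂ = s(a₃, a₂))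
    (hf₃ : ends f₃ = s(a₃, o)) (hstar : ∀ e, a₃ ∈ ends e → e = f₁ ∨ e = f₂ ∨ e = f₃)
    (h31 : a₃ ≠ a₁) (h32 : a₃ ≠ a₂) (h3o : a₃ ≠ o) (h12 : f₁ ≠ f₂) (h13 : f₁ ≠ f₃) (h23 : f₂ ≠ f₃)
    {x y : V} (hx : x ≠ a₃) (hy : y ≠ a₃) :
    prob p (TEvent ends a₁ a₂ a₃ ∩ connEvent ends x y) =
      p f₂ * (1 - p f₁) * (1 - p f₃) *
          prob (pOut p ends a₃) (avoidAll ends a₂ {a₁} ∩ connEvent ends x y) +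
        (1 - p f₁) * (1 - p f₂) * p f₃ *
          prob (pOut p ends a₃) (avoidAll ends a₂ {a₁} ∩ connEvent ends a₂ o ∩ connEvent ends x y) +
        p f₂ * (1 - p f₁) * p f₃ *
          prob (pOut p ends a₃)
            (avoidAll ends a₂ {a₁} ∩ (connEvent ends o a₁)ᶜ ∩ glue23 ends a₂ o x y) := by
  have hf1 : a₃ ∈ ends f₁ := by rw [hf₁]; exact Sym2.mem_mk_left _ _
  have hf2 : a₃ ∈ ends f₂ := by rw [hf₂]; exact Sym2.mem_mk_left _ _
  have hf3 : a₃ ∈ ends f₃ := by rw [hf₃]; exact Sym2.mem_mk_left _ _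
  have fac : ∀ (A : Set (Config E)) (b₁ b₂ b₃ : Bool),
      prob p (viaStar ends a₃ A ∩ outc f₁ f₂ f₃ b₁ b₂ b₃) =
        prob (pOut p ends a₃) A * cw b₁ (p f₁) * cw b₂ (p f₂) * cw b₃ (p f₃) := by
    intro A b₁ b₂ b₃
    rw [prob_inter_outc p h12 h13 h23 (free_viaStar ends a₃ hf1 A) (free_viaStar ends a₃ hf2 A)
      (free_viaStar ends a₃ hf3 A), prob_viaStar]
  rw [prob_eq_sum_outc p f₁ f₂ f₃]
  simp only [Fintype.sum_bool]
  rw [T_inter_outc_f1 ends hf₁ (connEvent ends x y) (b₂ := true) (b₃ := true),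
    T_inter_outc_f1 ends hf₁ (connEvent ends x y) (b₂ := true) (b₃ := false),
    T_inter_outc_f1 ends hf₁ (connEvent ends x y) (b₂ := false) (b₃ := true),
    T_inter_outc_f1 ends hf₁ (connEvent ends x y) (b₂ := false) (b₃ := false),
    T_inter_outc_ccc ends hf₁ hf₂ hf₃ hstar h31 h32 h3o (connEvent ends x y),
    T_inter_outc_f2 ends hf₁ hf₂ hf₃ hstar h31 h32 h3o hx hy,
    T_inter_outc_f3 ends hf₁ hf₂ hf₃ hstar h31 h32 h3o hx hy,
    T_inter_outc_f23 ends hf₁ hf₂ hf₃ hstar h31 h32 h3o hx hy, fac, fac, fac, prob_empty]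
  simp only [cw, ↓reduceIte, Bool.false_eq_true]
  ring

end MassT

end StarO




namespace StarO

section MassQC

variable {V : Type*} {E : Type*} [Fintype E] [DecidableEq E] [Fintype V] [DecidableEq V]
  {R : Type*} [Field R] [LinearOrder R] [IsStrictOrderedRing R]

variable (p : E → R) (ends : E → Sym2 V) {f₁ f₂ f₃ : E} {a₃ a₁ a₂ o : V}

/-- The connections of the star-closed configuration with `a₁` and `o` glued. -/
def glue13 (a₁ o x y : V) : Set (Config E) :=
  connEvent ends x y ∪ ((connEvent ends x a₁ ∩ connEvent ends o y) ∪
    (connEvent ends x o ∩ connEvent ends a₁ y))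

omit [Fintype E] [DecidableEq E] in
/-- `Q ∩ (x ↔ y) ∩ outc` on a single-glue outcome. -/
lemma Qc_inter_outc_single (hf₁ : ends f₁ = s(a₃, a₁)) (hf₂ : ends f₂ = s(a₃, a₂))
    (hf₃ : ends f₃ = s(a₃, o)) (hstar : ∀ e, a₃ ∈ ends e → e = f₁ ∨ e = f₂ ∨ e = f₃)
    (h31 : a₃ ≠ a₁) (h32 : a₃ ≠ a₂) (h3o : a₃ ≠ o) {x y : V} (hx : x ≠ a₃) (hy : y ≠ a₃)
    {b₁ b₂ b₃ : Bool} (hb1 : ¬ (b₁ = true ∧ b₂ = true)) (hb2 : ¬ (b₁ = true ∧ b₃ = true))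
    (hb3 : ¬ (b₂ = true ∧ b₃ = true)) :
    avoidAll ends a₂ {a₁} ∩ connEvent ends x y ∩ outc f₁ f₂ f₃ b₁ b₂ b₃ =
      viaStar ends a₃ (avoidAll ends a₂ {a₁} ∩ connEvent ends x y) ∩ outc f₁ f₂ f₃ b₁ b₂ b₃ := by
  ext ω
  simp only [Set.mem_inter_iff, mem_outc, viaStar, Set.mem_setOf_eq, avoidAll_eq_compl,
    Set.mem_compl_iff, mem_connEvent]
  constructor
  · rintro ⟨⟨hQ, hxy⟩, h1, h2, h3⟩
    have hs : ∀ {u v : V}, u ≠ a₃ → v ≠ a₃ →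
        (Conn ends ω u v ↔ Conn ends (closeStar ends a₃ ω) u v) := fun hu hv =>
      conn_iff_single hf₁ hf₂ hf₃ hstar h31 h32 h3o (by rw [h1, h2]; exact hb1)
        (by rw [h1, h3]; exact hb2) (by rw [h2, h3]; exact hb3) hu hv
    rw [hs h31.symm h32.symm] at hQ
    rw [hs hx hy] at hxy
    exact ⟨⟨hQ, hxy⟩, h1, h2, h3⟩
  · rintro ⟨⟨hQ, hxy⟩, h1, h2, h3⟩
    have hs : ∀ {u v : V}, u ≠ a₃ → v ≠ a₃ →
        (Conn ends ω u v ↔ Conn ends (closeStar ends a₃ ω) u v) := fun hu hv =>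
      conn_iff_single hf₁ hf₂ hf₃ hstar h31 h32 h3o (by rw [h1, h2]; exact hb1)
        (by rw [h1, h3]; exact hb2) (by rw [h2, h3]; exact hb3) hu hv
    refine ⟨⟨?_, ?_⟩, h1, h2, h3⟩
    · rw [hs h31.symm h32.symm]; exact hQ
    · rw [hs hx hy]; exact hxy

omit [Fintype E] [DecidableEq E] in
/-- `Q ∩ (x ↔ y) ∩ outc` with `f₁, f₃` open. -/
lemma Qc_inter_outc_13 (hf₁ : ends f₁ = s(a₃, a₁)) (hf₂ : ends f₂ = s(a₃, a₂))
    (hf₃ : ends f₃ = s(a₃, o)) (hstar : ∀ e, a₃ ∈ ends e → e = f₁ ∨ e = f₂ ∨ e = f₃)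
    (h31 : a₃ ≠ a₁) (h32 : a₃ ≠ a₂) (h3o : a₃ ≠ o) {x y : V} (hx : x ≠ a₃) (hy : y ≠ a₃) :
    avoidAll ends a₂ {a₁} ∩ connEvent ends x y ∩ outc f₁ f₂ f₃ true false true =
      viaStar ends a₃ (avoidAll ends a₂ {a₁} ∩ (connEvent ends a₂ o)ᶜ ∩ glue13 ends a₁ o x y) ∩
        outc f₁ f₂ f₃ true false true := by
  ext ω
  simp only [Set.mem_inter_iff, mem_outc, viaStar, Set.mem_setOf_eq, avoidAll_eq_compl,
    Set.mem_compl_iff, mem_connEvent, glue13, Set.mem_union]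
  constructor
  · rintro ⟨⟨hQ, hxy⟩, h1, h2, h3⟩
    rw [conn_iff_glue13 hf₁ hf₂ hf₃ hstar h31 h32 h3o h1 h2 h3 h31.symm h32.symm] at hQ
    rw [conn_iff_glue13 hf₁ hf₂ hf₃ hstar h31 h32 h3o h1 h2 h3 hx hy] at hxy
    push Not at hQ
    exact ⟨⟨⟨hQ.1, fun h => hQ.2.1 (conn_refl _ _ _) (conn_symm h)⟩, hxy⟩, h1, h2, h3⟩
  · rintro ⟨⟨⟨hQ, ho⟩, hxy⟩, h1, h2, h3⟩
    refine ⟨⟨?_, ?_⟩, h1, h2, h3⟩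
    · rw [conn_iff_glue13 hf₁ hf₂ hf₃ hstar h31 h32 h3o h1 h2 h3 h31.symm h32.symm]
      rintro (h | ⟨_, h⟩ | ⟨_, h⟩)
      · exact hQ h
      · exact ho (conn_symm h)
      · exact hQ h
    · rw [conn_iff_glue13 hf₁ hf₂ hf₃ hstar h31 h32 h3o h1 h2 h3 hx hy]
      exact hxy

omit [Fintype E] [DecidableEq E] in
/-- `Q ∩ (x ↔ y) ∩ outc` with `f₂, f₃` open. -/
lemma Qc_inter_outc_23 (hf₁ : ends f₁ = s(a₃, a₁)) (hf₂ : ends f₂ = s(a₃, a₂))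
    (hf₃ : ends f₃ = s(a₃, o)) (hstar : ∀ e, a₃ ∈ ends e → e = f₁ ∨ e = f₂ ∨ e = f₃)
    (h31 : a₃ ≠ a₁) (h32 : a₃ ≠ a₂) (h3o : a₃ ≠ o) {x y : V} (hx : x ≠ a₃) (hy : y ≠ a₃) :
    avoidAll ends a₂ {a₁} ∩ connEvent ends x y ∩ outc f₁ f₂ f₃ false true true =
      viaStar ends a₃ (avoidAll ends a₂ {a₁} ∩ (connEvent ends o a₁)ᶜ ∩ glue23 ends a₂ o x y) ∩
        outc f₁ f₂ f₃ false true true := by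
  ext ω
  simp only [Set.mem_inter_iff, mem_outc, viaStar, Set.mem_setOf_eq, avoidAll_eq_compl,
    Set.mem_compl_iff, mem_connEvent, glue23, Set.mem_union]
  constructor
  · rintro ⟨⟨hQ, hxy⟩, h1, h2, h3⟩
    rw [conn_iff_glue23 hf₁ hf₂ hf₃ hstar h31 h32 h3o h1 h2 h3 h31.symm h32.symm] at hQ
    rw [conn_iff_glue23 hf₁ hf₂ hf₃ hstar h31 h32 h3o h1 h2 h3 hx hy] at hxy
    push Not at hQ
    exact ⟨⟨⟨hQ.1, fun h => hQ.2.2 (conn_symm h) (conn_refl _ _ _)⟩, hxy⟩, h1, h2, h3⟩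
  · rintro ⟨⟨⟨hQ, ho⟩, hxy⟩, h1, h2, h3⟩
    refine ⟨⟨?_, ?_⟩, h1, h2, h3⟩
    · rw [conn_iff_glue23 hf₁ hf₂ hf₃ hstar h31 h32 h3o h1 h2 h3 h31.symm h32.symm]
      rintro (h | ⟨h, _⟩ | ⟨h, _⟩)
      · exact hQ h
      · exact hQ h
      · exact ho (conn_symm h)
    · rw [conn_iff_glue23 hf₁ hf₂ hf₃ hstar h31 h32 h3o h1 h2 h3 hx hy]
      exact hxy

omit [Fintype E] [DecidableEq E] [Fintype V] [DecidableEq V] in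
/-- `Q ∩ X ∩ outc` with both root coins open is empty. -/
lemma Qc_inter_outc_12 (hf₁ : ends f₁ = s(a₃, a₁)) (hf₂ : ends f₂ = s(a₃, a₂))
    (X : Set (Config E)) (b₃ : Bool) :
    avoidAll ends a₂ {a₁} ∩ X ∩ outc f₁ f₂ f₃ true true b₃ = ∅ := by
  ext ω
  simp only [Set.mem_inter_iff, mem_outc, avoidAll_eq_compl, Set.mem_compl_iff, mem_connEvent,
    Set.mem_empty_iff_false, iff_false, not_and]
  rintro ⟨hQ, _⟩ h1 h2 _
  exact hQ (conn_trans (conn_symm (conn_of_openAdj ⟨f₁, h1, hf₁⟩)) (conn_of_openAdj ⟨f₂, h2, hf₂⟩))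

omit [LinearOrder R] [IsStrictOrderedRing R] in
/-- **`P(Q, x ↔ y)`** for `x, y ≠ a₃`. -/
theorem prob_Q_inter_conn_star (hf₁ : ends f₁ = s(a₃, a₁)) (hf₂ : ends f₂ = s(a₃, a₂))
    (hf₃ : ends f₃ = s(a₃, o)) (hstar : ∀ e, a₃ ∈ ends e → e = f₁ ∨ e = f₂ ∨ e = f₃)
    (h31 : a₃ ≠ a₁) (h32 : a₃ ≠ a₂) (h3o : a₃ ≠ o) (h12 : f₁ ≠ f₂) (h13 : f₁ ≠ f₃) (h23 : f₂ ≠ f₃)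
    {x y : V} (hx : x ≠ a₃) (hy : y ≠ a₃) :
    prob p (avoidAll ends a₂ {a₁} ∩ connEvent ends x y) =
      (1 - p f₁ * p f₂ - p f₁ * (1 - p f₂) * p f₃ - p f₂ * (1 - p f₁) * p f₃) *
          prob (pOut p ends a₃) (avoidAll ends a₂ {a₁} ∩ connEvent ends x y) +
        p f₁ * (1 - p f₂) * p f₃ *
          prob (pOut p ends a₃)
            (avoidAll ends a₂ {a₁} ∩ (connEvent ends a₂ o)ᶜ ∩ glue13 ends a₁ o x y) +
        p f₂ * (1 - p f₁) * p f₃ *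
          prob (pOut p ends a₃)
            (avoidAll ends a₂ {a₁} ∩ (connEvent ends o a₁)ᶜ ∩ glue23 ends a₂ o x y) := by
  have hf1 : a₃ ∈ ends f₁ := by rw [hf₁]; exact Sym2.mem_mk_left _ _
  have hf2 : a₃ ∈ ends f₂ := by rw [hf₂]; exact Sym2.mem_mk_left _ _
  have hf3 : a₃ ∈ ends f₃ := by rw [hf₃]; exact Sym2.mem_mk_left _ _
  have fac : ∀ (A : Set (Config E)) (b₁ b₂ b₃ : Bool),
      prob p (viaStar ends a₃ A ∩ outc f₁ f₂ f₃ b₁ b₂ b₃) =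
        prob (pOut p ends a₃) A * cw b₁ (p f₁) * cw b₂ (p f₂) * cw b₃ (p f₃) := by
    intro A b₁ b₂ b₃
    rw [prob_inter_outc p h12 h13 h23 (free_viaStar ends a₃ hf1 A) (free_viaStar ends a₃ hf2 A)
      (free_viaStar ends a₃ hf3 A), prob_viaStar]
  rw [prob_eq_sum_outc p f₁ f₂ f₃]
  simp only [Fintype.sum_bool]
  rw [Qc_inter_outc_12 ends hf₁ hf₂ (connEvent ends x y) true,
    Qc_inter_outc_12 ends hf₁ hf₂ (connEvent ends x y) false,
    Qc_inter_outc_13 ends hf₁ hf₂ hf₃ hstar h31 h32 h3o hx hy,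
    Qc_inter_outc_23 ends hf₁ hf₂ hf₃ hstar h31 h32 h3o hx hy,
    Qc_inter_outc_single ends hf₁ hf₂ hf₃ hstar h31 h32 h3o hx hy (b₁ := true) (b₂ := false)
      (b₃ := false) (by simp) (by simp) (by simp),
    Qc_inter_outc_single ends hf₁ hf₂ hf₃ hstar h31 h32 h3o hx hy (b₁ := false) (b₂ := true)
      (b₃ := false) (by simp) (by simp) (by simp),
    Qc_inter_outc_single ends hf₁ hf₂ hf₃ hstar h31 h32 h3o hx hy (b₁ := false) (b₂ := false)
      (b₃ := true) (by simp) (by simp) (by simp),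
    Qc_inter_outc_single ends hf₁ hf₂ hf₃ hstar h31 h32 h3o hx hy (b₁ := false) (b₂ := false)
      (b₃ := false) (by simp) (by simp) (by simp), fac, fac, fac, fac, fac, fac, prob_empty]
  simp only [cw, ↓reduceIte, Bool.false_eq_true]
  ring

end MassQC

end StarO


end Summit.Ventures.PercRepro2
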